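import Summits.Ventures.Crystal3D.Theorems.StickyWulffConstantCoaxialWallLawHealCap
import HarnessLib

/-!
# HEAL-CAP, cap-table row «{100} SQUARE»: four further contacts of a ball missing a square face are the four SITES
# (crux `CoaxialWallLaw`, stmt-Ventures-19481; lane F v8 `JunkCapBound`)

HONEST FRAMING. Venture `Summits/Ventures/Crystal3D` (cell `crystal3d-full`); an elementary cap-packing lemma `--supports` the crux `CoaxialWallLaw`
(stmt-Ventures-19481, `route-Ventures-StickyWulffConstant`), line 'Certificates' v8, analytic input `JunkCapBound` of `stub_incoherentEndPools`
('…SeamIncoherentAssembly'): the CAP TABLE row «the eight slots off a SQUARE face of the frame dozen occupied».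
THE FACT.  Let the slots `k ∉ {0, 1, 4, 5}` (the eight slots with first cubic coordinate `≤ 0`; `{0,1,4,5}` is the square face of normal `(1,0,0)`) be
occupied around `y`, and let `u` be the direction of a further contact (`SquareFree u`: unit, inner product `≤ 1/2` with those eight slots).  In cubic
coordinates (`c = √2/2`) the four slots `(0,±1,±1)` give `|x₁| + |x₂| ≤ c`, whence `x₀ ≥ c` (`SquareFree.x0_ge`); for two such directions at mutual
inner product `≤ 1/2` the planar parts are NON-ACUTE (`x₁x₁' + x₂x₂' ≤ 0`), and four pairwise non-acute non-zero planar vectors form an orthogonal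
cross (`planar_cross`), which forces `x₀ = c`, `x₁ x₂ = 0`: **four pairwise `1`-separated further contacts are exactly the four square slots**
(`mem_squareSlots_of_four`), so AT MOST THREE further contacts avoid the four site positions (`card_offSite_contacts_le_three_of_square`).
NOTE for `JunkCapBound`: the empty square slots are NOT cappers (a {100} hollow is four-fold: its occupied shell neighbours `(0,1,1)`, `(0,1,−1)` are at
`90°`), so closure maximality does not exclude junk AT them — the fourth contact is excluded by this rigidity (four contacts sit at SITES).  Numerics
(19481-p1 g17 calc/healcap_rows.py): three off-site further contacts exist (slack `0.0116`), so the row is `3`.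
WHAT THIS IS NOT: no statement about pools or the stub; F-C1 not moved.
-/

noncomputable section

namespace Summit.Ventures.Crystal3D.Theorems

namespace TailResidue

open Summit.Ventures.Crystal3D Finset NearIdentity
open scoped InnerProductSpace

/-! ### The planar lemma -/

/-- **Four pairwise non-acute non-zero planar vectors form a cross**: the first is orthogonal to one of the others. -/
theorem planar_cross (y₁ z₁ y₂ z₂ y₃ z₃ y₄ z₄ : ℝ) (n₁ : 0 < y₁ ^ 2 + z₁ ^ 2) (n₂ : 0 < y₂ ^ 2 + z₂ ^ 2)
    (n₃ : 0 < y₃ ^ 2 + z₃ ^ 2) (n₄ : 0 < y₄ ^ 2 + z₄ ^ 2)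
    (h₁₂ : y₁ * y₂ + z₁ * z₂ ≤ 0) (h₁₃ : y₁ * y₃ + z₁ * z₃ ≤ 0) (h₁₄ : y₁ * y₄ + z₁ * z₄ ≤ 0)
    (h₂₃ : y₂ * y₃ + z₂ * z₃ ≤ 0) (h₂₄ : y₂ * y₄ + z₂ * z₄ ≤ 0) (h₃₄ : y₃ * y₄ + z₃ * z₄ ≤ 0) :
    y₁ * y₂ + z₁ * z₂ = 0 ∨ y₁ * y₃ + z₁ * z₃ = 0 ∨ y₁ * y₄ + z₁ * z₄ = 0 := by
  -- coordinates along `v₁` and `v₁⊥`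
  set α₂ := y₁ * y₂ + z₁ * z₂ with hα₂
  set α₃ := y₁ * y₃ + z₁ * z₃ with hα₃
  set α₄ := y₁ * y₄ + z₁ * z₄ with hα₄
  set β₂ := -z₁ * y₂ + y₁ * z₂ with hβ₂
  set β₃ := -z₁ * y₃ + y₁ * z₃ with hβ₃
  set β₄ := -z₁ * y₄ + y₁ * z₄ with hβ₄
  have i23 : (y₁ ^ 2 + z₁ ^ 2) * (y₂ * y₃ + z₂ * z₃) = α₂ * α₃ + β₂ * β₃ := by rw [hα₂, hα₃, hβ₂, hβ₃]; ring
  have i24 : (y₁ ^ 2 + z₁ ^ 2) * (y₂ * y₄ + z₂ * z₄) = α₂ * α₄ + β₂ * β₄ := by rw [hα₂, hα₄, hβ₂, hβ₄]; ring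
  have i34 : (y₁ ^ 2 + z₁ ^ 2) * (y₃ * y₄ + z₃ * z₄) = α₃ * α₄ + β₃ * β₄ := by rw [hα₃, hα₄, hβ₃, hβ₄]; ring
  have n2' : (y₁ ^ 2 + z₁ ^ 2) * (y₂ ^ 2 + z₂ ^ 2) = α₂ ^ 2 + β₂ ^ 2 := by rw [hα₂, hβ₂]; ring
  have n3' : (y₁ ^ 2 + z₁ ^ 2) * (y₃ ^ 2 + z₃ ^ 2) = α₃ ^ 2 + β₃ ^ 2 := by rw [hα₃, hβ₃]; ring
  have n4' : (y₁ ^ 2 + z₁ ^ 2) * (y₄ ^ 2 + z₄ ^ 2) = α₄ ^ 2 + β₄ ^ 2 := by rw [hα₄, hβ₄]; ring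
  have p23 : α₂ * α₃ + β₂ * β₃ ≤ 0 := by rw [← i23]; exact mul_nonpos_of_nonneg_of_nonpos n₁.le h₂₃
  have p24 : α₂ * α₄ + β₂ * β₄ ≤ 0 := by rw [← i24]; exact mul_nonpos_of_nonneg_of_nonpos n₁.le h₂₄
  have p34 : α₃ * α₄ + β₃ * β₄ ≤ 0 := by rw [← i34]; exact mul_nonpos_of_nonneg_of_nonpos n₁.le h₃₄
  have a23 : 0 ≤ α₂ * α₃ := mul_nonneg_of_nonpos_of_nonpos h₁₂ h₁₃
  have a24 : 0 ≤ α₂ * α₄ := mul_nonneg_of_nonpos_of_nonpos h₁₂ h₁₄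
  have a34 : 0 ≤ α₃ * α₄ := mul_nonneg_of_nonpos_of_nonpos h₁₃ h₁₄
  have b23 : β₂ * β₃ ≤ 0 := by linarith
  have b24 : β₂ * β₄ ≤ 0 := by linarith
  have b34 : β₃ * β₄ ≤ 0 := by linarith
  have q2 : 0 < α₂ ^ 2 + β₂ ^ 2 := by rw [← n2']; exact mul_pos n₁ n₂
  have q3 : 0 < α₃ ^ 2 + β₃ ^ 2 := by rw [← n3']; exact mul_pos n₁ n₃
  have q4 : 0 < α₄ ^ 2 + β₄ ^ 2 := by rw [← n4']; exact mul_pos n₁ n₄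
  -- one of the `β` vanishes
  have key : β₂ = 0 ∨ β₃ = 0 ∨ β₄ = 0 := by
    by_contra hne
    push Not at hne
    obtain ⟨hb2, hb3, hb4⟩ := hne
    have : 0 < (β₂ * β₃) * (β₂ * β₄) * (β₃ * β₄) := by
      have : (β₂ * β₃) * (β₂ * β₄) * (β₃ * β₄) = (β₂ * β₃ * β₄) ^ 2 := by ring
      rw [this]; positivity
    have h1 : 0 ≤ (β₂ * β₃) * (β₂ * β₄) := mul_nonneg_of_nonpos_of_nonpos b23 b24
    nlinarith [mul_nonpos_of_nonneg_of_nonpos h1 b34]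
  -- if `β_j = 0` then `α_j < 0`, which forces the other two `α` to vanish
  rcases key with hb | hb | hb
  · have ha : α₂ < 0 := by
      rcases lt_or_eq_of_le h₁₂ with h | h
      · exact h
      · exfalso; rw [hb, h] at q2; norm_num at q2
    right; left
    have hp : α₂ * α₃ ≤ 0 := by rw [hb, zero_mul, add_zero] at p23; exact p23
    have h3 : 0 ≤ α₃ := by
      by_contra hn; push Not at hn
      have := mul_pos_of_neg_of_neg ha hn; linarith
    exact le_antisymm h₁₃ h3
  · have ha : α₃ < 0 := by
      rcases lt_or_eq_of_le h₁₃ with h | h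
      · exact h
      · exfalso; rw [hb, h] at q3; norm_num at q3
    left
    have hp : α₂ * α₃ ≤ 0 := by rw [hb, mul_zero, add_zero] at p23; exact p23
    have h3 : 0 ≤ α₂ := by
      by_contra hn; push Not at hn
      have := mul_pos_of_neg_of_neg hn ha; linarith
    exact le_antisymm h₁₂ h3
  · have ha : α₄ < 0 := by
      rcases lt_or_eq_of_le h₁₄ with h | h
      · exact h
      · exfalso; rw [hb, h] at q4; norm_num at q4
    left
    have hp : α₂ * α₄ ≤ 0 := by rw [hb, mul_zero, add_zero] at p24; exact p24
    have h3 : 0 ≤ α₂ := by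
      by_contra hn; push Not at hn
      have := mul_pos_of_neg_of_neg hn ha; linarith
    exact le_antisymm h₁₂ h3

/-! ### The square-free region -/

/-- The eight slots off the square face `{0, 1, 4, 5}` (first cubic coordinate `≤ 0`). -/
def offSquare : Finset (Fin 12) := {2, 3, 6, 7, 8, 9, 10, 11}

/-- A SQUARE-FREE direction: unit, at inner product `≤ 1/2` with the eight slots off the square face. -/
def SquareFree (u : EuclideanSpace ℝ (Fin 3)) : Prop :=
  ‖u‖ = 1 ∧ ∀ k ∈ offSquare, ⟪u, slotSite k⟫_ℝ ≤ 1 / 2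

/-- The eight linear constraints of a square-free direction in cubic coordinates (`c = √2/2`). -/
theorem SquareFree.constraints {u : EuclideanSpace ℝ (Fin 3)} (h : SquareFree u) :
    cubicCoords u 1 + cubicCoords u 2 ≤ Real.sqrt 2 / 2 ∧ cubicCoords u 1 - cubicCoords u 2 ≤ Real.sqrt 2 / 2 ∧
    -cubicCoords u 1 + cubicCoords u 2 ≤ Real.sqrt 2 / 2 ∧ -cubicCoords u 1 - cubicCoords u 2 ≤ Real.sqrt 2 / 2 ∧
    -cubicCoords u 0 + cubicCoords u 1 ≤ Real.sqrt 2 / 2 ∧ -cubicCoords u 0 - cubicCoords u 1 ≤ Real.sqrt 2 / 2 ∧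
    -cubicCoords u 0 + cubicCoords u 2 ≤ Real.sqrt 2 / 2 ∧ -cubicCoords u 0 - cubicCoords u 2 ≤ Real.sqrt 2 / 2 := by
  have hs : 0 < Real.sqrt 2 := by positivity
  have h2 : Real.sqrt 2 * Real.sqrt 2 = 2 := Real.mul_self_sqrt (by norm_num)
  have key : ∀ k ∈ offSquare, cubicCoords u 0 * slotInt k 0 + cubicCoords u 1 * slotInt k 1 + cubicCoords u 2 * slotInt k 2 ≤ Real.sqrt 2 / 2 := by
    intro k hk
    have := h.2 k hk
    rw [inner_slotSite_right, div_le_iff₀ hs] at this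
    nlinarith
  have e2 := key 2 (by decide); have e3 := key 3 (by decide); have e6 := key 6 (by decide); have e7 := key 7 (by decide)
  have e8 := key 8 (by decide); have e9 := key 9 (by decide); have e10 := key 10 (by decide); have e11 := key 11 (by decide)
  simp only [slotInt, Matrix.cons_val_zero, Matrix.cons_val_one, Matrix.cons_val] at e2 e3 e6 e7 e8 e9 e10 e11
  norm_num at e2 e3 e6 e7 e8 e9 e10 e11
  exact ⟨by linarith, by linarith, by linarith, by linarith, by linarith, by linarith, by linarith, by linarith⟩

/-- **The first coordinate of a square-free direction is `≥ √2/2`** (and its planar part has squared norm `≤ 1/2`). -/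
theorem SquareFree.x0_ge {u : EuclideanSpace ℝ (Fin 3)} (h : SquareFree u) :
    Real.sqrt 2 / 2 ≤ cubicCoords u 0 ∧ cubicCoords u 1 ^ 2 + cubicCoords u 2 ^ 2 ≤ 1 / 2 := by
  obtain ⟨a, b, c', d, e, f, g, k⟩ := h.constraints
  have hn := cubicCoords_sq_sum h.1
  have hs : 0 < Real.sqrt 2 / 2 := by positivity
  have hcc : (Real.sqrt 2 / 2) * (Real.sqrt 2 / 2) = 1 / 2 := by
    have h2 : Real.sqrt 2 * Real.sqrt 2 = 2 := Real.mul_self_sqrt (by norm_num)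
    nlinarith
  have hlt1 : Real.sqrt 2 / 2 < 1 := by nlinarith
  -- planar part: `x₁² + x₂² = ((x₁+x₂)² + (x₁−x₂)²)/2 ≤ c²`
  have hp : (cubicCoords u 1 + cubicCoords u 2) ^ 2 ≤ 1 / 2 := by
    have h1 : |cubicCoords u 1 + cubicCoords u 2| ≤ Real.sqrt 2 / 2 := abs_le.2 ⟨by linarith, by linarith⟩
    have := sq_le_sq' (abs_le.1 h1).1 (abs_le.1 h1).2
    nlinarith
  have hm : (cubicCoords u 1 - cubicCoords u 2) ^ 2 ≤ 1 / 2 := by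
    have h1 : |cubicCoords u 1 - cubicCoords u 2| ≤ Real.sqrt 2 / 2 := abs_le.2 ⟨by linarith, by linarith⟩
    have := sq_le_sq' (abs_le.1 h1).1 (abs_le.1 h1).2
    nlinarith
  have hplanar : cubicCoords u 1 ^ 2 + cubicCoords u 2 ^ 2 ≤ 1 / 2 := by nlinarith
  refine ⟨?_, hplanar⟩
  have hx0sq : 1 / 2 ≤ cubicCoords u 0 ^ 2 := by linarith
  by_contra hlt
  push Not at hlt
  -- then `x₀ ≤ −c`, and the constraints `−x₀ ± x₁ ≤ c` force `x₁ = x₂ = 0`, `x₀² = 1`, `−x₀ = 1 ≤ c`: absurd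
  have hneg : cubicCoords u 0 ≤ -(Real.sqrt 2 / 2) := by nlinarith
  have hx1 : cubicCoords u 1 = 0 := by
    have : |cubicCoords u 1| ≤ 0 := abs_le.2 ⟨by linarith, by linarith⟩
    exact abs_nonpos_iff.1 this
  have hx2 : cubicCoords u 2 = 0 := by
    have : |cubicCoords u 2| ≤ 0 := abs_le.2 ⟨by linarith, by linarith⟩
    exact abs_nonpos_iff.1 this
  rw [hx1, hx2] at hn
  nlinarith

/-- Two square-free directions at mutual inner product `≤ 1/2` have NON-ACUTE planar parts; if the planar parts are orthogonal, both first
coordinates equal `√2/2`. -/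
theorem SquareFree.pair {u u' : EuclideanSpace ℝ (Fin 3)} (h : SquareFree u) (h' : SquareFree u') (huu : ⟪u, u'⟫_ℝ ≤ 1 / 2) :
    cubicCoords u 1 * cubicCoords u' 1 + cubicCoords u 2 * cubicCoords u' 2 ≤ 0 ∧
    (cubicCoords u 1 * cubicCoords u' 1 + cubicCoords u 2 * cubicCoords u' 2 = 0 →
      cubicCoords u 0 = Real.sqrt 2 / 2 ∧ cubicCoords u' 0 = Real.sqrt 2 / 2) := by
  have hx := h.x0_ge.1
  have hx' := h'.x0_ge.1
  have hc0 : 0 < Real.sqrt 2 / 2 := by positivity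
  have hcc : (Real.sqrt 2 / 2) * (Real.sqrt 2 / 2) = 1 / 2 := by
    have h2 : Real.sqrt 2 * Real.sqrt 2 = 2 := Real.mul_self_sqrt (by norm_num)
    nlinarith
  have hI : cubicCoords u 0 * cubicCoords u' 0 + cubicCoords u 1 * cubicCoords u' 1 + cubicCoords u 2 * cubicCoords u' 2 ≤ 1 / 2 := by
    rw [← inner_eq_cubicCoords_three]; exact huu
  have hxx : 1 / 2 ≤ cubicCoords u 0 * cubicCoords u' 0 := by
    have h1 := mul_le_mul hx hx' hc0.le (le_trans hc0.le hx)
    linarith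
  refine ⟨by linarith, fun h0 => ?_⟩
  have hprod : cubicCoords u 0 * cubicCoords u' 0 = 1 / 2 := by linarith
  -- `x₀, x₀' ≥ c` with product `c²` forces both `= c`
  have hu : cubicCoords u 0 = Real.sqrt 2 / 2 := by
    by_contra hne
    have hgt : Real.sqrt 2 / 2 < cubicCoords u 0 := lt_of_le_of_ne hx (Ne.symm hne)
    have := mul_lt_mul hgt hx' hc0 (le_trans hc0.le hgt.le)
    linarith
  refine ⟨hu, ?_⟩
  rw [hu] at hprod
  have : Real.sqrt 2 / 2 * (cubicCoords u' 0 - Real.sqrt 2 / 2) = 0 := by linarith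
  rcases mul_eq_zero.1 this with h1 | h1
  · exact absurd h1 (ne_of_gt hc0)
  · linarith

/-- Cubic coordinates of the four square slots `0, 1, 4, 5`. -/
theorem cubicCoords_square_slots :
    cubicCoords (slotSite 0) = ![Real.sqrt 2 / 2, Real.sqrt 2 / 2, 0] ∧ cubicCoords (slotSite 1) = ![Real.sqrt 2 / 2, -(Real.sqrt 2 / 2), 0] ∧
    cubicCoords (slotSite 4) = ![Real.sqrt 2 / 2, 0, Real.sqrt 2 / 2] ∧ cubicCoords (slotSite 5) = ![Real.sqrt 2 / 2, 0, -(Real.sqrt 2 / 2)] := by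
  have hs : 0 < Real.sqrt 2 := by positivity
  have h2 : Real.sqrt 2 * Real.sqrt 2 = 2 := Real.mul_self_sqrt (by norm_num)
  refine ⟨?_, ?_, ?_, ?_⟩ <;>
    (rw [cubicCoords_slotSite]; ext i; fin_cases i <;> simp [slotVec, slotInt] <;> field_simp <;> nlinarith)

/-- A square-free direction with `x₀ = √2/2` is one of the four square slots. -/
theorem SquareFree.eq_slot {u : EuclideanSpace ℝ (Fin 3)} (h : SquareFree u) (hx : cubicCoords u 0 = Real.sqrt 2 / 2) :
    u = slotSite 0 ∨ u = slotSite 1 ∨ u = slotSite 4 ∨ u = slotSite 5 := by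
  obtain ⟨a, b, c', d, -, -, -, -⟩ := h.constraints
  have hn := cubicCoords_sq_sum h.1
  have hs : 0 < Real.sqrt 2 := by positivity
  have hc0 : 0 < Real.sqrt 2 / 2 := by positivity
  have hcc : (Real.sqrt 2 / 2) * (Real.sqrt 2 / 2) = 1 / 2 := by
    have h2 : Real.sqrt 2 * Real.sqrt 2 = 2 := Real.mul_self_sqrt (by norm_num)
    nlinarith
  have hpl : cubicCoords u 1 ^ 2 + cubicCoords u 2 ^ 2 = 1 / 2 := by rw [hx] at hn; nlinarith
  -- `|x₁| + |x₂| ≤ c` and `x₁² + x₂² = c²` force `x₁ x₂ = 0`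
  have h12 : cubicCoords u 1 * cubicCoords u 2 = 0 := by
    rcases le_total 0 (cubicCoords u 1) with h1 | h1 <;> rcases le_total 0 (cubicCoords u 2) with h2 | h2
    · have hsum : (cubicCoords u 1 + cubicCoords u 2) ^ 2 ≤ 1 / 2 := by
        have := mul_self_le_mul_self (by linarith : 0 ≤ cubicCoords u 1 + cubicCoords u 2) a
        nlinarith
      nlinarith [mul_nonneg h1 h2]
    · have hsum : (cubicCoords u 1 - cubicCoords u 2) ^ 2 ≤ 1 / 2 := by
        have := mul_self_le_mul_self (by linarith : 0 ≤ cubicCoords u 1 - cubicCoords u 2) b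
        nlinarith
      nlinarith [mul_nonpos_of_nonneg_of_nonpos h1 h2]
    · have hsum : (-cubicCoords u 1 + cubicCoords u 2) ^ 2 ≤ 1 / 2 := by
        have := mul_self_le_mul_self (by linarith : 0 ≤ -cubicCoords u 1 + cubicCoords u 2) c'
        nlinarith
      nlinarith [mul_nonpos_of_nonpos_of_nonneg h1 h2]
    · have hsum : (-cubicCoords u 1 - cubicCoords u 2) ^ 2 ≤ 1 / 2 := by
        have := mul_self_le_mul_self (by linarith : 0 ≤ -cubicCoords u 1 - cubicCoords u 2) d
        nlinarith
      nlinarith [mul_nonneg_of_nonpos_of_nonpos h1 h2]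
  obtain ⟨hc0', hc1', hc4', hc5'⟩ := cubicCoords_square_slots
  have mk : ∀ {k : Fin 12} {a b c : ℝ}, cubicCoords (slotSite k) = ![a, b, c] → cubicCoords u 0 = a → cubicCoords u 1 = b →
      cubicCoords u 2 = c → u = slotSite k := by
    intro k a b c hk h0 h1 h2
    apply cubicCoords_injective; rw [hk]; ext i; fin_cases i
    · exact h0
    · exact h1
    · exact h2
  rcases mul_eq_zero.1 h12 with h1 | h2'
  · -- `x₁ = 0`, `x₂ = ±c` : slots 4 or 5
    have hf : (cubicCoords u 2 - Real.sqrt 2 / 2) * (cubicCoords u 2 + Real.sqrt 2 / 2) = 0 := by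
      have : cubicCoords u 2 ^ 2 = 1 / 2 := by rw [h1] at hpl; linarith
      nlinarith
    rcases mul_eq_zero.1 hf with h | h
    · exact Or.inr (Or.inr (Or.inl (mk hc4' hx h1 (by linarith))))
    · exact Or.inr (Or.inr (Or.inr (mk hc5' hx h1 (by linarith))))
  · -- `x₂ = 0`, `x₁ = ±c` : slots 0 or 1
    have hf : (cubicCoords u 1 - Real.sqrt 2 / 2) * (cubicCoords u 1 + Real.sqrt 2 / 2) = 0 := by
      have : cubicCoords u 1 ^ 2 = 1 / 2 := by rw [h2'] at hpl; linarith
      nlinarith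
    rcases mul_eq_zero.1 hf with h | h
    · exact Or.inl (mk hc0' hx (by linarith) h2')
    · exact Or.inr (Or.inl (mk hc1' hx (by linarith) h2'))

/-! ### Four further contacts are the four sites -/

/-- The planar part of a square-free direction that is `1`-separated from another square-free direction is non-zero. -/
theorem SquareFree.planar_pos {u u' : EuclideanSpace ℝ (Fin 3)} (h : SquareFree u) (h' : SquareFree u') (huu : ⟪u, u'⟫_ℝ ≤ 1 / 2) :
    0 < cubicCoords u 1 ^ 2 + cubicCoords u 2 ^ 2 := by
  have hn := cubicCoords_sq_sum h.1
  have hx := h.x0_ge.1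
  have hx' := h'.x0_ge.1
  have hc0 : 0 < Real.sqrt 2 / 2 := by positivity
  have hcc : (Real.sqrt 2 / 2) * (Real.sqrt 2 / 2) = 1 / 2 := by
    have h2 : Real.sqrt 2 * Real.sqrt 2 = 2 := Real.mul_self_sqrt (by norm_num)
    nlinarith
  have hI : cubicCoords u 0 * cubicCoords u' 0 + cubicCoords u 1 * cubicCoords u' 1 + cubicCoords u 2 * cubicCoords u' 2 ≤ 1 / 2 := by
    rw [← inner_eq_cubicCoords_three]; exact huu
  by_contra hnp
  push Not at hnp
  have h1 : cubicCoords u 1 = 0 := by nlinarith [sq_nonneg (cubicCoords u 1), sq_nonneg (cubicCoords u 2)]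
  have h2' : cubicCoords u 2 = 0 := by nlinarith [sq_nonneg (cubicCoords u 1), sq_nonneg (cubicCoords u 2)]
  rw [h1, h2'] at hn hI
  have hx1 : cubicCoords u 0 = 1 := by nlinarith
  rw [hx1] at hI
  have hlt : Real.sqrt 2 / 2 < 1 := by nlinarith
  nlinarith

/-- **{100} SQUARE, vector form**: four square-free directions pairwise at inner product `≤ 1/2` — the first is one of the four square slots
(apply with the arguments permuted for the others). -/
theorem SquareFree.mem_squareSlots_of_four {u₁ u₂ u₃ u₄ : EuclideanSpace ℝ (Fin 3)} (h₁ : SquareFree u₁) (h₂ : SquareFree u₂)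
    (h₃ : SquareFree u₃) (h₄ : SquareFree u₄) (h₁₂ : ⟪u₁, u₂⟫_ℝ ≤ 1 / 2) (h₁₃ : ⟪u₁, u₃⟫_ℝ ≤ 1 / 2) (h₁₄ : ⟪u₁, u₄⟫_ℝ ≤ 1 / 2)
    (h₂₃ : ⟪u₂, u₃⟫_ℝ ≤ 1 / 2) (h₂₄ : ⟪u₂, u₄⟫_ℝ ≤ 1 / 2) (h₃₄ : ⟪u₃, u₄⟫_ℝ ≤ 1 / 2) :
    u₁ = slotSite 0 ∨ u₁ = slotSite 1 ∨ u₁ = slotSite 4 ∨ u₁ = slotSite 5 := by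
  have n₁ := h₁.planar_pos h₂ h₁₂
  have n₂ := h₂.planar_pos h₁ (by rwa [real_inner_comm])
  have n₃ := h₃.planar_pos h₁ (by rwa [real_inner_comm])
  have n₄ := h₄.planar_pos h₁ (by rwa [real_inner_comm])
  obtain ⟨p12, e12⟩ := h₁.pair h₂ h₁₂
  obtain ⟨p13, e13⟩ := h₁.pair h₃ h₁₃
  obtain ⟨p14, e14⟩ := h₁.pair h₄ h₁₄
  obtain ⟨p23, -⟩ := h₂.pair h₃ h₂₃
  obtain ⟨p24, -⟩ := h₂.pair h₄ h₂₄
  obtain ⟨p34, -⟩ := h₃.pair h₄ h₃₄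
  rcases planar_cross _ _ _ _ _ _ _ _ n₁ n₂ n₃ n₄ p12 p13 p14 p23 p24 p34 with h0 | h0 | h0
  · exact h₁.eq_slot (e12 h0).1
  · exact h₁.eq_slot (e13 h0).1
  · exact h₁.eq_slot (e14 h0).1

/-! ### Packing forms -/

/-- A further contact of a ball with the eight off-square positions occupied gives a square-free direction. -/
theorem squareFree_of_contact {X : Finset (EuclideanSpace ℝ (Fin 3))} (hX : ∀ p ∈ X, ∀ q ∈ X, p ≠ q → 1 ≤ dist p q)
    (L : EuclideanSpace ℝ (Fin 3) ≃ₗᵢ[ℝ] EuclideanSpace ℝ (Fin 3)) {y x : EuclideanSpace ℝ (Fin 3)}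
    (hocc : ∀ k ∈ offSquare, y + L (slotSite k) ∈ X) (hx : x ∈ X) (hd : dist y x = 1)
    (hne : ∀ k ∈ offSquare, x ≠ y + L (slotSite k)) : SquareFree (L.symm (x - y)) := by
  have hxy : ‖x - y‖ = 1 := by rw [← dist_eq_norm, dist_comm]; exact hd
  refine ⟨by rw [LinearIsometryEquiv.norm_map]; exact hxy, fun k hk => ?_⟩
  have h1 : ⟪L.symm (x - y), slotSite k⟫_ℝ = ⟪x - y, L (slotSite k)⟫_ℝ := by
    rw [← L.inner_map_map (L.symm (x - y)) (slotSite k), LinearIsometryEquiv.apply_symm_apply]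
  rw [h1]
  refine inner_le_half_of_norm_sub_ge_one hxy (by rw [LinearIsometryEquiv.norm_map]; exact norm_eq_one_of_mem_fccSlots (slotSite_mem k)) ?_
  have : x - y - L (slotSite k) = x - (y + L (slotSite k)) := by abel
  rw [this, ← dist_eq_norm]
  exact hX x hx _ (hocc k hk) (hne k hk)

/-- The four square slots (the SITE positions of the empty face). -/
def squareSlots : Finset (Fin 12) := {0, 1, 4, 5}

/-- **{100} SQUARE, packing form**: in a `1`-separated configuration let the eight positions `y + L(slotSite k)`, `k ∈ offSquare`, be occupied; among any
four DISTINCT further contacts of `y`, the first sits at one of the four site positions `y + L(slotSite k)`, `k ∈ {0,1,4,5}`. -/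
theorem further_contact_mem_sites_of_four {X : Finset (EuclideanSpace ℝ (Fin 3))} (hX : ∀ p ∈ X, ∀ q ∈ X, p ≠ q → 1 ≤ dist p q)
    (L : EuclideanSpace ℝ (Fin 3) ≃ₗᵢ[ℝ] EuclideanSpace ℝ (Fin 3)) {y : EuclideanSpace ℝ (Fin 3)}
    (hocc : ∀ k ∈ offSquare, y + L (slotSite k) ∈ X) {a b c d : EuclideanSpace ℝ (Fin 3)}
    (ha : a ∈ X ∧ dist y a = 1 ∧ ∀ k ∈ offSquare, a ≠ y + L (slotSite k))
    (hb : b ∈ X ∧ dist y b = 1 ∧ ∀ k ∈ offSquare, b ≠ y + L (slotSite k))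
    (hc : c ∈ X ∧ dist y c = 1 ∧ ∀ k ∈ offSquare, c ≠ y + L (slotSite k))
    (hd : d ∈ X ∧ dist y d = 1 ∧ ∀ k ∈ offSquare, d ≠ y + L (slotSite k))
    (hab : a ≠ b) (hac : a ≠ c) (had : a ≠ d) (hbc : b ≠ c) (hbd : b ≠ d) (hcd : c ≠ d) :
    ∃ k ∈ squareSlots, a = y + L (slotSite k) := by
  have fa := squareFree_of_contact hX L hocc ha.1 ha.2.1 ha.2.2
  have fb := squareFree_of_contact hX L hocc hb.1 hb.2.1 hb.2.2
  have fc := squareFree_of_contact hX L hocc hc.1 hc.2.1 hc.2.2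
  have fd := squareFree_of_contact hX L hocc hd.1 hd.2.1 hd.2.2
  have hin : ∀ {p q : EuclideanSpace ℝ (Fin 3)}, p ∈ X → q ∈ X → p ≠ q → dist y p = 1 → dist y q = 1 →
      ⟪L.symm (p - y), L.symm (q - y)⟫_ℝ ≤ 1 / 2 := by
    intro p q hp hq hpq hdp hdq
    rw [L.symm.inner_map_map]
    refine inner_le_half_of_norm_sub_ge_one (by rw [← dist_eq_norm, dist_comm]; exact hdp)
      (by rw [← dist_eq_norm, dist_comm]; exact hdq) ?_
    have : p - y - (q - y) = p - q := by abel
    rw [this, ← dist_eq_norm]; exact hX p hp q hq hpq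
  have key := fa.mem_squareSlots_of_four fb fc fd (hin ha.1 hb.1 hab ha.2.1 hb.2.1) (hin ha.1 hc.1 hac ha.2.1 hc.2.1)
    (hin ha.1 hd.1 had ha.2.1 hd.2.1) (hin hb.1 hc.1 hbc hb.2.1 hc.2.1) (hin hb.1 hd.1 hbd hb.2.1 hd.2.1)
    (hin hc.1 hd.1 hcd hc.2.1 hd.2.1)
  have back : ∀ {k : Fin 12}, L.symm (a - y) = slotSite k → a = y + L (slotSite k) := by
    intro k h
    have : a - y = L (slotSite k) := by rw [← h, LinearIsometryEquiv.apply_symm_apply]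
    rw [← this]; abel
  rcases key with h | h | h | h
  · exact ⟨0, by simp [squareSlots], back h⟩
  · exact ⟨1, by simp [squareSlots], back h⟩
  · exact ⟨4, by simp [squareSlots], back h⟩
  · exact ⟨5, by simp [squareSlots], back h⟩

open scoped Classical in
/-- **Cap-table row «{100} square»**: in a `1`-separated configuration, a ball `y` with the eight positions `y + L(slotSite k)`, `k ∈ offSquare`,
occupied has AT MOST THREE contacts that are neither one of those eight balls nor at one of the four SITE positions of the empty square face. -/
theorem card_offSite_contacts_le_three_of_square {X : Finset (EuclideanSpace ℝ (Fin 3))} (hX : ∀ p ∈ X, ∀ q ∈ X, p ≠ q → 1 ≤ dist p q)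
    (L : EuclideanSpace ℝ (Fin 3) ≃ₗᵢ[ℝ] EuclideanSpace ℝ (Fin 3)) {y : EuclideanSpace ℝ (Fin 3)}
    (hocc : ∀ k ∈ offSquare, y + L (slotSite k) ∈ X) :
    (X.filter fun x => dist y x = 1 ∧ (∀ k ∈ offSquare, x ≠ y + L (slotSite k)) ∧
      ∀ k ∈ squareSlots, x ≠ y + L (slotSite k)).card ≤ 3 := by
  by_contra hlt
  push Not at hlt
  obtain ⟨a, b, c, d, ha, hb, hc, hd, hab, hac, had, hbc, hbd, hcd⟩ := three_lt_card_iff.1 hlt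
  simp only [mem_filter] at ha hb hc hd
  obtain ⟨k, hk, hak⟩ := further_contact_mem_sites_of_four hX L hocc ⟨ha.1, ha.2.1, ha.2.2.1⟩ ⟨hb.1, hb.2.1, hb.2.2.1⟩
    ⟨hc.1, hc.2.1, hc.2.2.1⟩ ⟨hd.1, hd.2.1, hd.2.2.1⟩ hab hac had hbc hbd hcd
  exact ha.2.2.2 k hk hak

end TailResidue

end Summit.Ventures.Crystal3D.Theorems

end
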